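import Summits.FinalStateConjecture.FinalStateConjecture.Theorems.PhaseMixingCaptureBulkKerrCaptureC2CentreKerrFamily
import Literature.Geometry.Lorentzian.CauchyDevelopmentConstSmul
import Literature.Geometry.Lorentzian.NullInfinityConstSmul
import Literature.Geometry.Lorentzian.LateChartDilation
import Literature.Geometry.Lorentzian.KerrSchildHomogeneity
import Literature.Geometry.Lorentzian.InitialDataHomothety
import HarnessLib

/-!
# Crux `PhaseMixingCapture.BulkKerrCaptureC2` (stmt-FinalStateConjecture-14985): SCALE COVARIANCE of the
# conclusion of the crux — the development side of the mass normalisation `M ↦ 1`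

Support file for the crux `BulkKerrCaptureC2` (sub-extremal Kerr capture in the bulk, import grade).  Its
matrix `CaptureC2At s δ M _ ε η a` (`Negative.BlockForm`) is stated for EVERY mass `M > 0`, but the Kerr family
is homothetic (`Kerr.bilin_dilate`) and the vacuum equations are scale covariant, so the crux ought to be
equivalent to its unit-mass slice.  This file proves the DEVELOPMENT half of that reduction (the companion
`…ScalingData.lean` treats the data ball, `…MassNormalisation.lean` assembles the equivalence).
Let `l > 0` and let `D` be a datum on the big slice `Kerr.slice (la) (lM)`; its **shrink**
`D₀ := ((y ↦ l y)^* D).homothety l⁻¹` is the datum on `Kerr.slice a M` with Cartesian components `h₀(y) = h(l y)`,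
`k₀(y) = l k(l y)`.  **If the conclusion of the crux — far-completeness and `C²`-convergence of a region to a
sub-extremal `g_{M',a'}` with `|M' − M| + |a' − a| ≤ η` — holds for every maximal vacuum Cauchy development of
`D₀`, then it holds, with witness `(lM', la')` and tolerance `lη`, for every maximal vacuum Cauchy development of
`D`** (`conclusion_of_shrink`): a maximal development `𝒟 = (𝓜, g, τ, ι, ν)` of `D`, re-based along the slice
dilation and rescaled to `(𝓜, l⁻² g, τ, ι ∘ (l ·), l ν ∘ (l ·))` (`DataEmbedding.comapAlong`,
`VacuumCauchyDevelopment.constSmul`), is a MAXIMAL development of `D₀` (`embedsInto_comapAlong_of_isMaximal` —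
maximality transported along a diffeomorphism `N ≃ₜ X` of data manifolds of DIFFERENT types, the tree's
`IsMaximal.precomp` being `N = X` — and `isMaximal_constSmul`); the hypothesis applies to it; sojourn
completeness of `𝓘⁺` from the far region descends (`hasCompleteFutureNullInfinityFrom_of_constSmul`,
`hasCompleteFutureNullInfinityFrom_of_comapAlong`, `sliceShrink_farCompatible`), and `Cᵏ`-convergence to
`g_{M',a'}` of `(𝓜, c² g)` is `Cᵏ`-convergence to `g_{c⁻¹M', c⁻¹a'}` of `(𝓜, g)` (`convergesToKerr_of_constSmul`,
via `LateChartDilation.lean`).  Everything is proved; no definitions, no named facts.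
References: Choquet-Bruhat–Geroch, CMP 14 (1969), p. 330; Ringström 2009, Def. 16.2–16.5; Bartnik–Isenberg
2004, §2; Kerr–Schild 1965, §2; Christodoulou, CQG 16 (1999) A23, pp. A26–A27; DHRT arXiv:2104.08222, §1;
O'Neill 1983, Ch. 3, Thm. 3.11, Ch. 14.
-/

-- the doubled `FinalStateConjecture.FinalStateConjecture` path component trips dupNamespace
set_option linter.dupNamespace false

noncomputable section

open Set Filter Function Topology Bundle
open scoped Manifold ContDiff Topology
open Literature.Geometry.Lorentzian
open Summit.FinalStateConjecture.FinalStateConjecture.Theorems.NearExtremalKappaCapture.UnitTemperatureFrontFace.CentreFarComplete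
  (isCompact_shell mem_slice_of_afRadius_le)
open Summit.FinalStateConjecture.FinalStateConjecture.Theorems.BulkKerrCapture.Negative (range_farSliceIncl)
open Summit.FinalStateConjecture.FinalStateConjecture.Theorems.BulkKerrCaptureC2.Centre
  (exists_vacuumCauchyDevelopment_comapAlong sliceScale_smooth)

namespace Summit.FinalStateConjecture.FinalStateConjecture.Theorems.BulkKerrCaptureC2.Scaling

/-! ## §1 Re-basing along a diffeomorphism of data manifolds of different types: functoriality, maximality -/

section Rebase

variable {X N : Type} [TopologicalSpace X] [ChartedSpace E3 X] [IsManifold (𝓡 3) ∞ X]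
  [TopologicalSpace N] [ChartedSpace E3 N] [IsManifold (𝓡 3) ∞ N]

/-- **Pulling back along a diffeomorphism and then along its inverse gives the datum back**:
`(F⁻¹)^*(F^* D) = (F ∘ F⁻¹)^* D = D` for a homeomorphism `F : N ≃ₜ X` of `3`-manifolds, smooth with
injective differentials in both directions (heterogeneous version of the tree's
`InitialDataSet.comap_comp_eq_self`, which has `N = X`). O'Neill 1983, Ch. 3, p. 58. [cite: ONeill1983, Ch. 3, p. 58] -/
theorem comap_symm_comap (D : InitialDataSet (𝓡 3) X) (F : N ≃ₜ X)
    (hF : ContMDiff (𝓡 3) (𝓡 3) (∞ + 1) F) (hF' : ∀ u, Injective (mfderiv (𝓡 3) (𝓡 3) F u))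
    (hFs : ContMDiff (𝓡 3) (𝓡 3) (∞ + 1) F.symm)
    (hFs' : ∀ u, Injective (mfderiv (𝓡 3) (𝓡 3) F.symm u)) :
    (D.comap F hF hF').comap F.symm hFs hFs' = D := by
  have hd : ∀ u, MDifferentiableAt (𝓡 3) (𝓡 3) F (F.symm u) := fun u ↦
    (hF.of_le le_self_add).mdifferentiableAt (by simp)
  have hds : ∀ u, MDifferentiableAt (𝓡 3) (𝓡 3) F.symm u := fun u ↦
    (hFs.of_le le_self_add).mdifferentiableAt (by simp)
  have hcomp : ContMDiff (𝓡 3) (𝓡 3) (∞ + 1) (F ∘ F.symm) := hF.comp hFs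
  have hcomp' : ∀ u, Injective (mfderiv (𝓡 3) (𝓡 3) (F ∘ F.symm) u) := fun u ↦ by
    rw [mfderiv_comp u (hd u) (hds u)]
    exact (hF' _).comp (hFs' u)
  have h1 : (D.comap F hF hF').comap F.symm hFs hFs' = D.comap (F ∘ F.symm) hcomp hcomp' := by
    refine InitialDataSet.ext' (fun u v w ↦ ?_) (fun u v w ↦ ?_)
    · simp only [InitialDataSet.comap_h_inner]
      rw [mfderiv_comp u (hd u) (hds u)]
      rfl
    · simp only [InitialDataSet.comap_k]
      rw [mfderiv_comp u (hd u) (hds u)]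
      rfl
  rw [h1]
  exact D.comap_eq_self_of_eq_id _ _ (funext F.apply_symm_apply)

variable [ConnectedSpace X] [ConnectedSpace N] {D : InitialDataSet (𝓡 3) X}

/-- **The universal property of a maximal development survives re-basing along a diffeomorphism of data
manifolds of different types.**  If `𝒟 = (𝓜, g, τ, ι, ν)` is a maximal vacuum Cauchy development of `D` on `X`
and `F : N ≃ₜ X` is a diffeomorphism (smooth with injective differentials, inverse likewise), then every vacuum
Cauchy development `𝒟'` of `F^* D` embeds into the re-based data embedding `(𝓜, g, τ, ι ∘ F, ν ∘ F)`
(`DataEmbedding.comapAlong`): `𝒟'` re-based along `F⁻¹` develops `(F⁻¹)^* F^* D = D` (`comap_symm_comap`), so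
embeds into `𝒟` by maximality through some `ψ` with `ψ ∘ ι' ∘ F⁻¹ = ι`, i.e. `ψ ∘ ι' = ι ∘ F`.  (The tree's
`IsMaximal.precomp` is the case `N = X`.)  Choquet-Bruhat–Geroch 1969, p. 330; Ringström 2009, Def. 16.5.
[cite: Ringstrom2009, Def. 16.5] -/
theorem embedsInto_comapAlong_of_isMaximal (𝒟 : VacuumCauchyDevelopment D) (hmax : 𝒟.IsMaximal)
    (F : N ≃ₜ X) (hF : ContMDiff (𝓡 3) (𝓡 3) (∞ + 1) F) (hF' : ∀ u, Injective (mfderiv (𝓡 3) (𝓡 3) F u))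
    (hFs : ContMDiff (𝓡 3) (𝓡 3) (∞ + 1) F.symm)
    (hFs' : ∀ u, Injective (mfderiv (𝓡 3) (𝓡 3) F.symm u))
    (𝒟' : VacuumCauchyDevelopment (D.comap F hF hF')) :
    𝒟'.toDataEmbedding.EmbedsInto
      (𝒟.toDataEmbedding.comapAlong F hF hF' F.isOpenEmbedding
        fun u ↦ 𝒟.toDataEmbedding.mdifferentiableAt_embed_normal (F u)) := by
  have hD : (D.comap F hF hF').comap F.symm hFs hFs' = D := comap_symm_comap D F hF hF' hFs hFs'
  -- `𝒟'` re-based along `F⁻¹`: a development of `(F⁻¹)^* F^* D`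
  let 𝒟'' : VacuumCauchyDevelopment ((D.comap F hF hF').comap F.symm hFs hFs') :=
    { toDataEmbedding := 𝒟'.toDataEmbedding.comapAlong F.symm hFs hFs' F.symm.isOpenEmbedding
        fun u ↦ 𝒟'.toDataEmbedding.mdifferentiableAt_embed_normal (F.symm u)
      isCauchyHypersurface := by
        show 𝒟'.metric.IsCauchyHypersurface 𝒟'.timeOrientation (range (𝒟'.embed ∘ F.symm))
        rw [F.symm.surjective.range_comp]
        exact 𝒟'.isCauchyHypersurface
      isRicciFlat := by
        intro inst
        haveI : 𝒟'.metric.toPseudoRiemannianMetric.HasLeviCivita := inst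
        exact 𝒟'.isRicciFlat }
  obtain ⟨ψ, hψs, hψo, hψi, hψt, hψe⟩ :=
    VacuumCauchyDevelopment.IsMaximal.exists_embedding_of_eq hD hmax 𝒟''
  refine ⟨ψ, hψs, hψo, hψi, hψt, ?_⟩
  funext x
  have hx := congrFun hψe (F x)
  change ψ (𝒟'.embed (F.symm (F x))) = 𝒟.embed (F x) at hx
  rw [F.symm_apply_apply] at hx
  exact hx

end Rebase

/-! ## §2 The conclusion descends along a constant rescaling and back along a re-basing -/

section Descend

variable {X N : Type} [TopologicalSpace X] [ChartedSpace E3 X] [IsManifold (𝓡 3) ∞ X] [ConnectedSpace X]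
  [TopologicalSpace N] [ChartedSpace E3 N] [IsManifold (𝓡 3) ∞ N] [ConnectedSpace N]
  {D : InitialDataSet (𝓡 3) X}

/-- **Restricted-origin sojourn completeness of `𝓘⁺` is dilation covariant.**  If the dilate
`(𝓜, c² g, τ, ι, c⁻¹ ν)` of the vacuum Cauchy development `𝒟 = (𝓜, g, τ, ι, ν)` (`VacuumCauchyDevelopment.constSmul`)
has complete `𝓘⁺` as seen from the origins `A` (`DataEmbedding.HasCompleteFutureNullInfinityFrom`), so has `𝒟`:
for the threshold `s` use the compact set provided for `c s`; a `(g, ν)`-normalised ray `γ` from `p ∈ A` rescales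
to the `(c² g, c⁻¹ ν)`-normalised ray `t ↦ γ (c⁻¹ t)` (`isNormalisedNullRayFrom_constSmul_comp_mul`), future
complete iff `γ` is, whose sojourn time in `J⁺(ι B₀)` — the same set for both metrics — is `c` times that of `γ`
(`sojournTime_comp_mul`).  The all-origins case is the tree's `hasCompleteFutureNullInfinity_of_constSmul`.
Christodoulou, CQG 16 (1999), pp. A26–A27. [cite: Christodoulou1999, pp. A26–A27] -/
theorem hasCompleteFutureNullInfinityFrom_of_constSmul (𝒟 : VacuumCauchyDevelopment D) {c : ℝ} (hc : 0 < c)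
    {D' : InitialDataSet (𝓡 3) X}
    (hh : ∀ (x : X) (v w : TangentSpace (𝓡 3) x), D'.h.inner x v w = c ^ 2 * D.h.inner x v w)
    (hk : ∀ (x : X) (v w : TangentSpace (𝓡 3) x), D'.k x v w = c * D.k x v w) {A : Set X}
    (h : (𝒟.constSmul c hc D' hh hk).HasCompleteFutureNullInfinityFrom A) :
    𝒟.HasCompleteFutureNullInfinityFrom A := by
  intro inst
  haveI : 𝒟.metric.HasLeviCivita := inst
  haveI i2 : (𝒟.metric.constSmul (c ^ 2) (pow_pos hc 2)).HasLeviCivita :=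
    PseudoRiemannianMetric.HasLeviCivita.constSmul (g := 𝒟.metric.toPseudoRiemannianMetric)
      (c ^ 2) (pow_pos hc 2).ne'
  obtain ⟨B₀, hB₀, hB⟩ := @h i2
  refine ⟨B₀, hB₀, fun s hs ↦ ?_⟩
  obtain ⟨B₁, hB₁, hB'⟩ := hB (c * s) (mul_pos hc hs)
  refine ⟨B₁, hB₁, fun p hp hpB γ dom hγ ↦ ?_⟩
  rcases hB' p hp hpB _ _
      (𝒟.metric.isNormalisedNullRayFrom_constSmul_comp_mul 𝒟.timeOrientation 𝒟.embed 𝒟.normal hc hγ)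
    with hb | hsoj
  · exact Or.inl fun hb' ↦ hb ((bddAbove_preimage_mul_iff (inv_pos.2 hc)).2 hb')
  · right
    change ENNReal.ofReal (c * s) ≤ sojournTime (fun t ↦ γ (c⁻¹ * t)) ((fun t ↦ c⁻¹ * t) ⁻¹' dom)
      ((𝒟.metric.constSmul (c ^ 2) (pow_pos hc 2)).causalFuture
        (𝒟.timeOrientation.constSmul (c ^ 2) (pow_pos hc 2)) (𝒟.embed '' B₀)) at hsoj
    rw [𝒟.metric.causalFuture_constSmul 𝒟.timeOrientation (pow_pos hc 2),
      sojournTime_comp_mul γ dom _ (inv_pos.2 hc), inv_inv, ENNReal.ofReal_mul hc.le] at hsoj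
    exact (ENNReal.mul_le_mul_iff_right ((ENNReal.ofReal_pos.2 hc).ne') ENNReal.ofReal_ne_top).1 hsoj

/-- **Restricted-origin sojourn completeness of `𝓘⁺` descends along the re-basing of a data embedding by a
diffeomorphism whose inverse is far-compatible.**  If the re-based data embedding `(𝓜, g, τ, ι ∘ F, ν ∘ F)`
(`DataEmbedding.comapAlong`, `F : N ≃ₜ X`) has complete `𝓘⁺` as seen from the origins `A ⊆ N`, and `F⁻¹` maps
the origins `A' ⊆ X` into `A` off a compact set `C' ⊆ X`, then `(𝓜, g, τ, ι, ν)` has complete `𝓘⁺` as seen from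
`A'`: reference set `F B₀` (so that `ι (F B₀) = (ι ∘ F) B₀`), exemption set `F B₁ ∪ C'`; a normalised null ray from
`F q ∈ A' ∖ (F B₁ ∪ C')` for `(ι, ν)` IS one from `q ∈ A ∖ B₁` for `(ι ∘ F, ν ∘ F)`.  (Converse direction of
`Centre.hasCompleteFutureNullInfinityFrom_comapAlong`.)  Christodoulou, CQG 16 (1999), pp. A26–A27;
Dafermos–Rodnianski arXiv:0811.0354, §2.6.2. [cite: Christodoulou1999, pp. A26–A27] -/
theorem hasCompleteFutureNullInfinityFrom_of_comapAlong (𝒮 : DataEmbedding D) (F : N ≃ₜ X)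
    (hF : ContMDiff (𝓡 3) (𝓡 3) (∞ + 1) F) (hF' : ∀ u, Injective (mfderiv (𝓡 3) (𝓡 3) F u))
    (hν : ∀ u, MDifferentiableAt (𝓡 3) (𝓡 (3 + 1)).tangent
      (fun x ↦ (TotalSpace.mk' (EuclideanSpace ℝ (Fin (3 + 1))) (𝒮.embed x) (𝒮.normal x) :
        TangentBundle (𝓡 (3 + 1)) 𝒮.carrier)) (F u))
    {A : Set N} {A' C' : Set X} (hC' : IsCompact C')
    (hAC : ∀ p ∈ A', p ∉ C' → F.symm p ∈ A)
    (h : (𝒮.comapAlong F hF hF' F.isOpenEmbedding hν).HasCompleteFutureNullInfinityFrom A) :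
    𝒮.HasCompleteFutureNullInfinityFrom A' := by
  intro inst
  haveI : 𝒮.metric.HasLeviCivita := inst
  obtain ⟨B₀, hB₀, H⟩ := @h inst
  refine ⟨F '' B₀, hB₀.image F.continuous, fun s hs ↦ ?_⟩
  obtain ⟨B₁, hB₁, H₁⟩ := H s hs
  refine ⟨F '' B₁ ∪ C', (hB₁.image F.continuous).union hC', fun p hpA hpB γ dom hγ ↦ ?_⟩
  obtain ⟨q, rfl⟩ := F.surjective p
  have hqC : F q ∉ C' := fun h' ↦ hpB (Or.inr h')
  have hq₁ : q ∉ B₁ := fun h' ↦ hpB (Or.inl ⟨q, h', rfl⟩)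
  have hqA : q ∈ A := by
    have := hAC (F q) hpA hqC
    rwa [F.symm_apply_apply] at this
  have hγ' : 𝒮.metric.IsNormalisedNullRayFrom 𝒮.timeOrientation (𝒮.embed ∘ F) (fun u ↦ 𝒮.normal (F u))
      q γ dom := hγ
  have himg : (𝒮.embed ∘ F) '' B₀ = 𝒮.embed '' (F '' B₀) := Set.image_comp _ _ _
  have key := H₁ q hqA hq₁ γ dom hγ'
  change ¬ BddAbove dom ∨ ENNReal.ofReal s ≤
    sojournTime γ dom (𝒮.metric.causalFuture 𝒮.timeOrientation ((𝒮.embed ∘ F) '' B₀)) at key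
  rwa [himg] at key

/-- **`Cᵏ`-convergence to Kerr is dilation covariant.**  If the rescaled spacetime `(𝓜, c² g, τ)` has a region `O`
converging in `Cᵏ` to `g_{M,a}` (`Spacetime.ConvergesToKerr`), then `(𝓜, g, τ)` has the same region converging in
`Cᵏ` to `g_{c⁻¹M, c⁻¹a}`: precompose the late-time chart `Ψ : Kerr.exterior M a → 𝓜` with the dilation
`δ : Kerr.exterior (c⁻¹M) (c⁻¹a) → Kerr.exterior M a`, `y ↦ c y`, which intertwines the Kerr–Schild forms
(`Kerr.bilin_dilate`), the times `t*` (factor `c`) and the radii (`Kerr.radius_smul`); `Ψ ∘ δ` is a late-time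
chart after `c⁻¹ τ₀` (`isLateChart_comp_dilate`) covering the same late region, whose complement in `O` lies in
the causal past of the same initial slab (`causalPast_constSmul`), and the slab deviations of `Ψ ∘ δ` decay
(`tendsto_deviationCk_comp_dilate`).  DHRT arXiv:2104.08222, §1 (the notion); Kerr–Schild 1965, §2 (scale
covariance of the family). [cite: KerrSchild1965, §2] -/
theorem convergesToKerr_of_constSmul (𝓢 : Spacetime.{0} 4) {c : ℝ} (hc : 0 < c) {O : Set 𝓢.carrier}
    {M a : ℝ} {k : ℕ} (h : (𝓢.constSmul (c ^ 2) (pow_pos hc 2)).ConvergesToKerr O M a k) :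
    𝓢.ConvergesToKerr O (c⁻¹ * M) (c⁻¹ * a) k := by
  have hc0 : c ≠ 0 := hc.ne'
  -- the dilation between the two Kerr exteriors
  have hdom : ∀ y : E4, y ∈ (Kerr.background (c⁻¹ * M) (c⁻¹ * a)).domain ↔
      c • y ∈ (Kerr.background M a).domain := by
    intro y
    have hr : Kerr.rPlus (c⁻¹ * M) (c⁻¹ * a) = c⁻¹ * Kerr.rPlus M a :=
      Kerr.rPlus_dilate (inv_pos.2 hc).le M a
    change y ∈ Kerr.region (c⁻¹ * a) (Kerr.rPlus (c⁻¹ * M) (c⁻¹ * a)) ↔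
      c • y ∈ Kerr.region a (Kerr.rPlus M a)
    rw [hr, ← Kerr.mem_region_dilate_iff hc (x := y), mul_inv_cancel_left₀ hc0,
      mul_inv_cancel_left₀ hc0]
  let δ : (Kerr.background (c⁻¹ * M) (c⁻¹ * a)).domain → (Kerr.background M a).domain :=
    fun y ↦ ⟨c • (y : E4), (hdom y).1 y.2⟩
  have hδ : ∀ x, (δ x : E4) = c • (x : E4) := fun _ ↦ rfl
  have hbil : ∀ y : E4, (Kerr.background (c⁻¹ * M) (c⁻¹ * a)).bilin y =
      (Kerr.background M a).bilin (c • y) := by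
    intro y
    change Kerr.bilin (c⁻¹ * M) (c⁻¹ * a) y = Kerr.bilin M a (c • y)
    have h1 := Kerr.bilin_dilate hc (c⁻¹ * M) (c⁻¹ * a) y
    rw [mul_inv_cancel_left₀ hc0, mul_inv_cancel_left₀ hc0] at h1
    exact h1.symm
  have htime : ∀ y : E4, (Kerr.background M a).time (c • y) =
      c * (Kerr.background (c⁻¹ * M) (c⁻¹ * a)).time y := by
    intro y
    change (c • y) 0 = c * y 0
    simp
  have hsurj : Surjective δ := surjective_dilate hc0 hδ hdom
  obtain ⟨τ₀, Ψ₀, hΨ₀, ht₀⟩ := h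
  -- retype the chart as a map into `𝓢.carrier` (the rescaled spacetime has the same carrier)
  let Ψ : (Kerr.background M a).domain → 𝓢.carrier := Ψ₀
  have hΨ : (𝓢.constSmul (c ^ 2) (pow_pos hc 2)).IsLateEmbedding (Kerr.background M a) O τ₀ Ψ := hΨ₀
  have ht : Tendsto (fun τ ↦ (𝓢.constSmul (c ^ 2) (pow_pos hc 2)).deviationCk (Kerr.background M a) Ψ k τ)
      atTop (𝓝 0) := ht₀
  have h1 : (Ψ ∘ δ) '' (Kerr.background (c⁻¹ * M) (c⁻¹ * a)).lateRegion (c⁻¹ * τ₀) =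
      Ψ '' (Kerr.background M a).lateRegion τ₀ :=
    image_comp_dilate Ψ hsurj fun x ↦ by
      have h2 := dilate_mem_lateRegion_iff hc hδ htime (c⁻¹ * τ₀) x
      rwa [mul_inv_cancel_left₀ hc0] at h2
  have h2 : (Ψ ∘ δ) '' (Kerr.background (c⁻¹ * M) (c⁻¹ * a)).timeSlab (c⁻¹ * τ₀) =
      Ψ '' (Kerr.background M a).timeSlab τ₀ :=
    image_comp_dilate Ψ hsurj fun x ↦ by
      have h2 := dilate_mem_timeSlab_iff hc hδ htime (c⁻¹ * τ₀) x
      rwa [mul_inv_cancel_left₀ hc0] at h2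
  refine ⟨c⁻¹ * τ₀, Ψ ∘ δ, ⟨𝓢.isLateChart_comp_dilate hc hδ hdom htime hΨ.toIsLateChart, ?_⟩,
    𝓢.tendsto_deviationCk_comp_dilate hc hδ hdom hbil htime hΨ.contMDiff ht⟩
  rw [h1, h2, ← 𝓢.metric.causalPast_constSmul 𝓢.timeOrientation (pow_pos hc 2)]
  exact hΨ.diff_subset_causalPast

end Descend

/-! ## §3 The slice contraction is far-compatible; the conclusion of the crux descends from the shrink -/

section Shrink

variable {M a : ℝ}

/-- **The slice contraction is far-compatible**: `z ↦ z / l`, `Kerr.slice (la) (lM) → Kerr.slice a M`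
(`Kerr.sliceShrinkHomeomorph`), maps the far region `{afRadius (la) (lM) + 1 ≤ ‖p‖}` of the big slice into the far
region `{afRadius a M + 1 ≤ ‖q‖}` of the small one off the compact norm shell
`{afRadius (la) (lM) + 1 ≤ ‖p‖ ≤ l (afRadius a M + 1)}` (`‖p / l‖ = ‖p‖ / l`; the shell lies in the slice for
`0 ≤ M`, `mem_slice_of_afRadius_le`, and is compact there, `isCompact_shell`). [folklore] -/
theorem sliceShrink_farCompatible (hM : 0 ≤ M) {l : ℝ} (hl : 0 < l) :
    IsCompact {p : Kerr.slice (l * a) (l * M) | Kerr.afRadius (l * a) (l * M) + 1 ≤ ‖(p : E3)‖ ∧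
        ‖(p : E3)‖ ≤ l * (Kerr.afRadius a M + 1)} ∧
      ∀ p : Kerr.slice (l * a) (l * M), Kerr.afRadius (l * a) (l * M) + 1 ≤ ‖(p : E3)‖ →
        p ∉ {p : Kerr.slice (l * a) (l * M) | Kerr.afRadius (l * a) (l * M) + 1 ≤ ‖(p : E3)‖ ∧
          ‖(p : E3)‖ ≤ l * (Kerr.afRadius a M + 1)} →
        Kerr.afRadius a M + 1 ≤ ‖((Kerr.sliceShrinkHomeomorph l hl a M) p : E3)‖ := by
  refine ⟨isCompact_shell fun y hy ↦ mem_slice_of_afRadius_le (mul_nonneg hl.le hM) hy, fun p hp hpC ↦ ?_⟩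
  have hlt : l * (Kerr.afRadius a M + 1) < ‖(p : E3)‖ := by
    by_contra h
    exact hpC ⟨hp, not_lt.1 h⟩
  have hcoe : ((Kerr.sliceShrinkHomeomorph l hl a M) p : E3) = l⁻¹ • (p : E3) := Kerr.coe_sliceShrink hl p
  rw [hcoe, norm_smul, Real.norm_of_nonneg (inv_nonneg.2 hl.le), le_inv_mul_iff₀ hl]
  exact hlt.le

/-- Sub-extremality is dilation invariant: `|a| < M → |l a| < l M` for `l > 0`. [folklore] -/
theorem isSubextremal_mul {M' a' l : ℝ} (hl : 0 < l) (h : Kerr.IsSubextremal M' a') :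
    Kerr.IsSubextremal (l * M') (l * a') := by
  unfold Kerr.IsSubextremal at h ⊢
  rw [abs_mul, abs_of_pos hl]; exact mul_lt_mul_of_pos_left h hl

variable [Kerr.SliceFacts]

/-- **The conclusion of the crux descends from the shrink (scale covariance of the conclusion).**  Let `l > 0`,
`0 ≤ M`, and let `D` be a datum on the big slice `Kerr.slice (la) (lM)`; its shrink is the datum
`D₀ = ((sliceShrinkHomeomorph l)⁻¹^* D).homothety l⁻¹` on `Kerr.slice a M` (Cartesian components `h₀(y) = h(ly)`,
`k₀(y) = l k(ly)`).  If every maximal vacuum Cauchy development of `D₀` is far-complete and has a region converging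
in `C²` to a sub-extremal `g_{M',a'}` with `|M' − M| + |a' − a| ≤ η`, then every maximal vacuum Cauchy development
`𝒟 = (𝓜, g, τ, ι, ν)` of `D` is far-complete and has a region converging in `C²` to a sub-extremal `g_{M'',a''}` with
`|M'' − lM| + |a'' − la| ≤ lη` (namely `(M'', a'') = (lM', la')`): the re-based rescaled development
`(𝓜, l⁻² g, τ, ι ∘ (l ·), l ν ∘ (l ·))` is a maximal development of `D₀` (`embedsInto_comapAlong_of_isMaximal`,
`isMaximal_constSmul`), the hypothesis applies to it, far-completeness descends
(`hasCompleteFutureNullInfinityFrom_of_constSmul`, `hasCompleteFutureNullInfinityFrom_of_comapAlong`,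
`sliceShrink_farCompatible`) and so does the convergence (`convergesToKerr_of_constSmul`).  Bartnik–Isenberg
2004, §2; Ringström 2009, Def. 16.5; Kerr–Schild 1965, §2. [cite: BartnikIsenberg2004, §2] -/
theorem conclusion_of_shrink (hM : 0 ≤ M) {l : ℝ} (hl : 0 < l) {η : ℝ}
    (D : InitialDataSet 𝓘(ℝ, E3) (Kerr.slice (l * a) (l * M)))
    (h : ∀ 𝒟₀ : VacuumCauchyDevelopment
        ((D.comap (Kerr.sliceShrinkHomeomorph l hl a M).symm (sliceScale_smooth hl a M).1
          (sliceScale_smooth hl a M).2).homothety l⁻¹ (inv_pos.2 hl)),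
      𝒟₀.IsMaximal → ∃ (M' a' : ℝ) (𝒟oc : Set 𝒟₀.carrier), Kerr.IsSubextremal M' a' ∧
        𝒟₀.HasCompleteFutureNullInfinityFar ∧ 𝒟₀.toSpacetime.ConvergesToKerr 𝒟oc M' a' 2 ∧
        |M' - M| + |a' - a| ≤ η)
    (𝒟 : VacuumCauchyDevelopment D) (hmax : 𝒟.IsMaximal) :
    ∃ (M'' a'' : ℝ) (𝒟oc : Set 𝒟.carrier), Kerr.IsSubextremal M'' a'' ∧
      𝒟.HasCompleteFutureNullInfinityFar ∧ 𝒟.toSpacetime.ConvergesToKerr 𝒟oc M'' a'' 2 ∧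
      |M'' - l * M| + |a'' - l * a| ≤ l * η := by
  set F : Kerr.slice a M ≃ₜ Kerr.slice (l * a) (l * M) := (Kerr.sliceShrinkHomeomorph l hl a M).symm with hFdef
  have hF : ContMDiff (𝓡 3) (𝓡 3) (∞ + 1) F := (sliceScale_smooth hl a M).1
  have hF' : ∀ u, Injective (mfderiv (𝓡 3) (𝓡 3) F u) := (sliceScale_smooth hl a M).2
  -- the inverse `F⁻¹ = sliceShrink` is smooth with injective differentials `v ↦ v / l`
  have hFs : ContMDiff (𝓡 3) (𝓡 3) (∞ + 1) F.symm :=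
    (Kerr.contMDiff_sliceShrink hl a M).of_le (le_of_eq (by rfl))
  have hFs' : ∀ u, Injective (mfderiv (𝓡 3) (𝓡 3) F.symm u) := by
    intro u v w hvw
    have hv : mfderiv 𝓘(ℝ, E3) 𝓘(ℝ, E3) (Kerr.sliceShrink l hl a M) u v = l⁻¹ • v :=
      Kerr.mfderiv_sliceShrink_apply hl u v
    have hw : mfderiv 𝓘(ℝ, E3) 𝓘(ℝ, E3) (Kerr.sliceShrink l hl a M) u w = l⁻¹ • w :=
      Kerr.mfderiv_sliceShrink_apply hl u w
    have h' : l⁻¹ • v = l⁻¹ • w := by rw [← hv, ← hw]; exact hvw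
    exact smul_right_injective E3 (inv_ne_zero hl.ne') h'
  -- `𝒟` re-based along `F`: a maximal development of `F^* D`
  let 𝒟₁ : VacuumCauchyDevelopment (D.comap F hF hF') :=
    { toDataEmbedding := 𝒟.toDataEmbedding.comapAlong F hF hF' F.isOpenEmbedding
        fun u ↦ 𝒟.toDataEmbedding.mdifferentiableAt_embed_normal (F u)
      isCauchyHypersurface := by
        show 𝒟.metric.IsCauchyHypersurface 𝒟.timeOrientation (range (𝒟.embed ∘ F))
        rw [F.surjective.range_comp]
        exact 𝒟.isCauchyHypersurface
      isRicciFlat := by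
        intro inst
        haveI : 𝒟.metric.toPseudoRiemannianMetric.HasLeviCivita := inst
        exact 𝒟.isRicciFlat }
  have hmax₁ : 𝒟₁.IsMaximal := fun 𝒟' ↦ embedsInto_comapAlong_of_isMaximal 𝒟 hmax F hF hF' hFs hFs' 𝒟'
  -- … rescaled by `l⁻¹`: a maximal development of the shrink
  have hh : ∀ (x : Kerr.slice a M) (v w : TangentSpace (𝓡 3) x),
      ((D.comap F hF hF').homothety l⁻¹ (inv_pos.2 hl)).h.inner x v w =
        l⁻¹ ^ 2 * (D.comap F hF hF').h.inner x v w := fun x v w ↦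
    InitialDataSet.homothety_h_inner _ _ x v w
  have hk : ∀ (x : Kerr.slice a M) (v w : TangentSpace (𝓡 3) x),
      ((D.comap F hF hF').homothety l⁻¹ (inv_pos.2 hl)).k x v w = l⁻¹ * (D.comap F hF hF').k x v w :=
    fun x v w ↦ InitialDataSet.homothety_k _ _ x v w
  have hmax₀ : (𝒟₁.constSmul l⁻¹ (inv_pos.2 hl) _ hh hk).IsMaximal :=
    𝒟₁.isMaximal_constSmul (inv_pos.2 hl) hh hk hmax₁
  obtain ⟨M', a', 𝒟oc, hsub, hfar₀, hconv₀, hpar⟩ := h _ hmax₀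
  refine ⟨l * M', l * a', 𝒟oc, isSubextremal_mul hl hsub, ?_, ?_, ?_⟩
  · -- far-completeness descends: first the rescaling, then the re-basing
    have hfar₁ : 𝒟₁.HasCompleteFutureNullInfinityFar :=
      hasCompleteFutureNullInfinityFrom_of_constSmul 𝒟₁ (inv_pos.2 hl) hh hk hfar₀
    obtain ⟨hC', hfarC⟩ := sliceShrink_farCompatible (a := a) hM hl
    rw [DataEmbedding.hasCompleteFutureNullInfinityFar_iff, range_farSliceIncl] at hfar₁ ⊢
    exact hasCompleteFutureNullInfinityFrom_of_comapAlong 𝒟.toDataEmbedding F hF hF'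
      (fun u ↦ 𝒟.toDataEmbedding.mdifferentiableAt_embed_normal (F u)) hC'
      (fun p hp hpC ↦ hfarC p hp hpC) hfar₁
  · -- convergence descends
    have hconv := convergesToKerr_of_constSmul 𝒟.toSpacetime (inv_pos.2 hl) hconv₀
    rwa [inv_inv] at hconv
  · -- the parameters
    have e1 : l * M' - l * M = l * (M' - M) := by ring
    have e2 : l * a' - l * a = l * (a' - a) := by ring
    rw [e1, e2, abs_mul, abs_mul, abs_of_pos hl, ← mul_add]
    exact mul_le_mul_of_nonneg_left hpar hl.le

end Shrink

/-- **Registered sub-goal `stub_conclusion_of_shrink`** (crux item stmt-FinalStateConjecture-14985): scale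
covariance of the conclusion of the crux — if every MGHD of the shrink `((sliceShrinkHomeomorph l)⁻¹^* D).homothety l⁻¹`
of a datum `D` on `Kerr.slice (la) (lM)` is far-complete with a region converging in `C²` to a sub-extremal Kerr metric
within `η` of `(M, a)`, then every MGHD of `D` is far-complete with a region converging in `C²` to a sub-extremal Kerr
metric within `lη` of `(lM, la)` (closed form of `conclusion_of_shrink`). [cite: BartnikIsenberg2004, §2] -/
theorem stub_conclusion_of_shrink : ∀ [Kerr.SliceFacts] (M a : ℝ) (hM : 0 ≤ M) (l : ℝ) (hl : 0 < l) (η : ℝ) (D : InitialDataSet 𝓘(ℝ, E3) (Kerr.slice (l * a) (l * M))), (∀ 𝒟₀ : VacuumCauchyDevelopment ((D.comap (Kerr.sliceShrinkHomeomorph l hl a M).symm (sliceScale_smooth hl a M).1 (sliceScale_smooth hl a M).2).homothety l⁻¹ (inv_pos.2 hl)), 𝒟₀.IsMaximal → ∃ (M' a' : ℝ) (𝒟oc : Set 𝒟₀.carrier), Kerr.IsSubextremal M' a' ∧ 𝒟₀.HasCompleteFutureNullInfinityFar ∧ 𝒟₀.toSpacetime.ConvergesToKerr 𝒟oc M' a'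 2 ∧ |M' - M| + |a' - a| ≤ η) → ∀ 𝒟 : VacuumCauchyDevelopment D, 𝒟.IsMaximal → ∃ (M'' a'' : ℝ) (𝒟oc : Set 𝒟.carrier), Kerr.IsSubextremal M'' a'' ∧ 𝒟.HasCompleteFutureNullInfinityFar ∧ 𝒟.toSpacetime.ConvergesToKerr 𝒟oc M'' a'' 2 ∧ |M'' - l * M| + |a'' - l * a| ≤ l * η :=
  fun _ _ hM _ hl _ D h 𝒟 hmax ↦ conclusion_of_shrink hM hl D h 𝒟 hmax

end Summit.FinalStateConjecture.FinalStateConjecture.Theorems.BulkKerrCaptureC2.Scaling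

end
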